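import Summits.QuantumFields.YangMills.Theorems.BalabanUVNodesN12DirectChartLetterCore
import Summits.QuantumFields.YangMills.Theorems.BalabanUVNodesN12NearFlatFederbushVelocityWindow
import Summits.QuantumFields.YangMills.Theorems.BalabanUVNodesN12NearFlatFederbushFibreWindowKnit

/-!
# DAG node N12 [B15] — THE CHART HALF OF THE DIRECT ROAD's (WD) PACKAGE, per instance: `∃ Ψ₂ lam p, hΨ₂ ∧ hΨd ∧ hlam ∧ hp ∧ ∀ X, (μ) ∧ (K) ∧ hmX`, from gauge-invariant letters
# (guard, plaquette smallness, window-tower near-flatness), the displayed right inverse `hH` ((P4)) and the displayed curvature `hM₂` ((P5), compact-uniform producer landed separately)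

Cell `pub-ymgap` (HUMAN RULINGS D-0062 ∕ D-0149), width seat `pub-ymgap-dag-n12-w4` g5; the lane owner's RE-PEN of (P2b) `(i)_direct = hWD_of_letters` (dag-n12-c g20, 2026-08-28 ≈18:04Z) and this
seat's answer «chart half mine»: EVERYTHING of the (WD) family letter `hWD` (p646359 §5) AFTER `C1_window ∧ P1 ∧ X_f 0 = 0 ∧ C² ∧ hmin` — the chart rows and the velocity-form Federbush clause —
assembled per instance from this seat's landed theorems; the gauge half (`C1_window`, `P1` producers) and the one-screen assembly `hWD_of_letters` are the lane's.  Key K1⁹ `stmt-QuantumFields-27364`,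
`--kind proof --supports … --as helper`; count-neutral; THEOREMS ONLY.  CONSUMED BY NAME: `…N12DirectChartLetterCore.chartRows_direct_of_letters` ∕ `exists_twistSize_of_nearFlat_feeds` (p654775),
`…N12NearFlatFederbushVelocityWindow.exists_hmX_federbush_window_of_isMinimizer_family` (p652991), `…N12NearFlatFederbushFibreWindowKnit.runSite_runSite_blockSite_mem_tower` (p646479),
`…FibreRecord.hcons_of_plaqsInside_maxDomT` (p604917), `Node00.differentiableAt_msChart` (p610492), this lineage's `ℓ²(HS)` bookkeeping (p629850), `B16Ineq19FlatSliceChart.exists_lieSU2Coord`.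

THE PRINT.  [Balaban1989LargeFieldII] (1.6)–(1.7) pp. 357–358, (1.12)–(1.13) p. 359; [Federbush1986PhaseCellI] (0.12) p. 321; [Balaban1985Variational] Sect. C (44)–(48) p. 285, (81)–(83)
p. 290; [Balaban1988Convergent] (2.10)–(2.13) pp. 256–257; [Balaban1989LargeFieldI] (8) p. 279.

CONTENTS.  §1 ★★★ `exists_hWD_chartHalf_of_letters` — FOUR per-height constants `C ρ K_τ ρ_τ` (the (δ₂)-component row's and the twist-size row's), then per instance (`Z, Λ, T, lo, hi`,
the base field `V_k` through `ext`, the (K′) family `X_f` with its minimiser `U₀`, the window `W` of fine plaquettes containing the tower-0 plaquettes of the box `(n+3)(lo−2)`, tolerances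
`εP, δ_W`): from `hmin0`∕`hmin` (K′), the guard `hsb`, plaquette smallness `hP`, the displayed `hH = (H, hHinv, hHB, hHsupp)` and `hM₂`, the (K′) velocity letters `hKb`∕`hsupp`, `X_f 0 = 0`,
`ContDiffAt 2`, and window-tower near-flatness `hδW` (`0 < δ_W < min ρ ρ_τ`, on the feeds of the four bonds of every `(e₀,e_ν)`-plaquette at the box's level-`k` sites) ⇒
`∃ Ψ₂ lam p, hΨ₂ ∧ hΨd ∧ hlam ∧ hp ∧ ∀ X, (μ) λ(Ψ₂(X_f′X,X_f′X)) ≤ (2(d−1)·εP·√#bonds·B·M₂)·p(X_f′X)² ∧ (K) p(X_f′X) ≤ Kc‖X‖ ∧ (hmX) (γ₀∕2)·circ X − τc·‖X‖² ≤ B_W (X_f′X) (X_f′X)` with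
`γ₀ = (L^d)^k∕(L²L²)^k`, `τ := 2(K_τ+1)δ_W`, `τc = γ₀·(8(d+1)τ + 8d·|S_k|·(C·δ_W·Kc)²)`, `Kc = 12𝓐₀∕R·√card`, `|S_k|` the box's level-`k` site count (η = ½ in p652991).

HONEST FRAMING.  Junction algebra BY NAME over landed kernel theorems; `hH` ((P4), pen-less) and `hM₂` ((P5): `Node00.exists_chartCurvature_sq_bound_on_compact` at a compact guard set) are
DISPLAYED; per-height ∕ per-instance constants, NOT print's volume-uniform `O(1)`; nothing of Bałaban's ((1.7), (1.12), Prop. 1) asserted; N12 NOT discharged; K1⁹ NOT closed; count-neutral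
(typed 28∕28 · discharged 5∕27 unmoved); one finite 𝕋⁴ programme at fixed ε — R4 closes the conditional rung `BalabanLadder.UV` only; the YM mass gap (Clay) is NOT proved by any of this.
-/

noncomputable section

open scoped BigOperators Matrix.Norms.L2Operator Topology
open Filter Finset

namespace Summit.QuantumFields.YangMills.BalabanUVNodes.N12DirectChartPackage

open Literature.MathematicalPhysics.QuantumFieldTheory.Balaban1983to89
open Literature.MathematicalPhysics.QuantumLattice (quatMatrix)
open T4Continuum (T4Family)
open T4HaarSU2ExpChart (imQuat)
open T4AdjointCovarianceUnitary (lieSU)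
open T4CubeChartGnomonic (SU2)
open B15DeterminingSets GaugeField
open B14.Eq213DetSet (Bj Bj_of_gt maxDomT)
open B14.Eq216Concrete (feeds)
open B15Prop1SliceCoordinates (GaugeSlice ιA)
open B15Prop1ChartCalculusSU2 (E3)
open B15Prop1ChartSU2 (su2Chart)
open B16Sect1Backgrounds (expMul)
open T4AxialGaugeSmallField (castSite)
open B6TreeGaugePoincare (curl)
open B16Eq18Proof (box)
open LatticeFieldCalculus (runSite)
open BlockAveragingEMLLinearised (linAvg)
open Literature.MathematicalPhysics.QuantumFieldTheory.BalabanImbrieJaffe1984to88.BIJ85Eq453GaugeField (qsstarGIter0)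
open Node00
open B16Ineq19FlatSliceChart (exists_lieSU2Coord)
open Summit.QuantumFields.YangMills.BalabanUVNodes.N12NearFlatChartLetter (sum_opNorm_sq_le_l2Seminorm_sq l2Seminorm_le_of_bound_of_support)
open Summit.QuantumFields.YangMills.BalabanUVNodes.N12NearFlatFederbushFibreRecord (hcons_of_plaqsInside_maxDomT)
open Summit.QuantumFields.YangMills.BalabanUVNodes.N12NearFlatFederbushFibreWindowKnit (runSite_runSite_blockSite_mem_tower)
open Summit.QuantumFields.YangMills.BalabanUVNodes.N12NearFlatFederbushVelocityWindow (exists_hmX_federbush_window_of_isMinimizer_family)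
open Summit.QuantumFields.YangMills.BalabanUVNodes.N12DirectChartLetterCore (chartRows_direct_of_letters exists_twistSize_of_nearFlat_feeds)

variable {F : T4Family}

/-! ## §1  The chart half of the (WD) package -/

section Package

variable {Kt : ℕ}

/-- ★★★ **THE CHART HALF OF THE (WD) PACKAGE, per instance** (see the module docstring for the letters, the constants and the reading). [cite: Balaban1989LargeFieldII, (1.7) pp.357–358, (1.12)–(1.13) p.359; Federbush1986PhaseCellI, 'Abelian Stability Theorem' (0.12) p.321; Balaban1985Variational, Sect. C (44)–(48) p.285, (81)–(83) p.290; Balaban1988Convergent, (2.10)–(2.13) pp.256–257; Balaban1989LargeFieldI, (8) p.279] -/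
theorem exists_hWD_chartHalf_of_letters (ν : Node00.Stage7Numerics) (Kt : ℕ) (h0 : 0 < (F.P Kt).d) {k : ℕ} (hk : k ≤ (F.P Kt).m + (F.P Kt).K)
    (Z Λ : Set (Site (F.P Kt) 0)) (T : Finset (PBond (F.P Kt) k)) (lo hi : Fin (F.P Kt).d → ℤ)
    (hbox : ∀ κ, ((((hi κ - lo κ + 1).toNat + 3 : ℕ) : ℤ)) ≤ (F.P Kt).sitesPerDir k)
    (hΩw : ∀ (ν' : Fin (F.P Kt).d), ∀ z ∈ box (fun κ => (hi κ - lo κ + 1).toNat + 3) (fun κ => lo κ - 2),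
      (castSite z : Site (F.P Kt) k) ∈ pts k (maxDomT ν.M₁ Z k) ∧ (castSite z : Site (F.P Kt) k).shift ⟨0, h0⟩ ∈ pts k (maxDomT ν.M₁ Z k) ∧
        (castSite z : Site (F.P Kt) k).shift ν' ∈ pts k (maxDomT ν.M₁ Z k)) :
    ∃ C ρ Kτ ρτ : ℝ, 0 ≤ C ∧ 0 < ρ ∧ 0 ≤ Kτ ∧ 0 < ρτ ∧
      ∀ (ext : GaugeField (F.P Kt) k SU2 → GaugeField (F.P Kt) k SU2) (Vk : GaugeField (F.P Kt) k SU2) ⦃R 𝓐₀ : ℝ⦄, 0 < R → 0 ≤ 𝓐₀ →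
      ∀ (U₀ : GaugeField (F.P Kt) 0 SU2) (Xf : GaugeSlice (pts k Λ) T E3 → PBond (F.P Kt) 0 → lieSU (Fin 2)),
      IsMinimizer (Node00.avOfRecord F 2 Kt) (Node00.regMSCoPOfRecord F 2 ν Kt k (maxDomT ν.M₁ Z)) (Bj ν.M₁ Z k)
        (avgFamily (Node00.avOfRecord F 2 Kt) (qsstarGIter0 k (ext Vk))) U₀ →
      SmallBelow (Node00.avOfRecord F 2 Kt) k U₀ →
      ∀ ⦃εP : ℝ⦄, 0 ≤ εP →
      (∀ p : Plaq (F.P Kt) 0, ((⟨p.src, p.μ⟩ : PBond (F.P Kt) 0) ∈ {b : PBond (F.P Kt) 0 | b.src ∈ maxDomT ν.M₁ Z 1} ∨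
          (⟨p.src.shift p.μ, p.ν⟩ : PBond (F.P Kt) 0) ∈ {b : PBond (F.P Kt) 0 | b.src ∈ maxDomT ν.M₁ Z 1} ∨
          (⟨p.src.shift p.ν, p.μ⟩ : PBond (F.P Kt) 0) ∈ {b : PBond (F.P Kt) 0 | b.src ∈ maxDomT ν.M₁ Z 1} ∨
          (⟨p.src, p.ν⟩ : PBond (F.P Kt) 0) ∈ {b : PBond (F.P Kt) 0 | b.src ∈ maxDomT ν.M₁ Z 1}) →
        ‖((GaugeField.plaqHol U₀ p : SU2) : Matrix (Fin 2) (Fin 2) ℂ) - 1‖ ≤ εP) →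
      ∀ (H : (Fin (constrCard (Bj ν.M₁ Z k) k) → lieSU (Fin 2)) → PBond (F.P Kt) 0 → lieSU (Fin 2)) ⦃B : ℝ⦄, 0 ≤ B →
      (∀ v, fderiv ℝ (msChart F 2 Kt k (Bj ν.M₁ Z k) (avgFamily (avOfRecord F 2 Kt) (qsstarGIter0 k (ext Vk))) U₀) 0 (H v) = v) →
      (∀ v, Real.sqrt (∑ b, ‖H v b‖ ^ 2) ≤ B * ‖v‖) →
      (∀ v (b : PBond (F.P Kt) 0), b.src ∉ maxDomT ν.M₁ Z 1 → H v b = 0) →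
      ∀ ⦃M₂ : ℝ⦄, 0 ≤ M₂ → (∀ w, ‖fderiv ℝ (fderiv ℝ (msChart F 2 Kt k (Bj ν.M₁ Z k) (avgFamily (avOfRecord F 2 Kt) (qsstarGIter0 k (ext Vk))) U₀)) 0 w w‖ ≤ M₂ * ‖w‖ ^ 2) →
      Xf 0 = 0 → ContDiffAt ℝ 2 Xf 0 →
      (∀ᶠ Y in 𝓝 (0 : GaugeSlice (pts k Λ) T E3),
        IsMinimizer (Node00.avOfRecord F 2 Kt) (Node00.regMSCoPOfRecord F 2 ν Kt k (maxDomT ν.M₁ Z)) (Bj ν.M₁ Z k)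
          (avgFamily (Node00.avOfRecord F 2 Kt) (qsstarGIter0 k (expMul su2Chart (ιA (pts k Λ) T Y) (ext Vk)))) (expChart U₀ (Xf Y))) →
      (∀ (X : GaugeSlice (pts k Λ) T E3) (b : PBond (F.P Kt) 0),
        ‖((fderiv ℝ Xf 0 X b : lieSU (Fin 2)) : Matrix (Fin 2) (Fin 2) ℂ)‖ ≤ 8 * 𝓐₀ / R * ‖X‖ ∧ ‖fderiv ℝ Xf 0 X b‖ ≤ 12 * 𝓐₀ / R * ‖X‖) →
      (∀ (X : GaugeSlice (pts k Λ) T E3) (b : PBond (F.P Kt) 0), b.src ∉ maxDomT ν.M₁ Z 1 → fderiv ℝ Xf 0 X b = 0) →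
      ∀ (W : Finset (Plaq (F.P Kt) 0)),
      (∀ q : Plaq (F.P Kt) 0, q.src ∈ ((box (fun κ => (F.P Kt).L ^ k * ((hi κ - lo κ + 1).toNat + 3 + 1) - 1) (fun κ => ((F.P Kt).L : ℤ) ^ k * (lo κ - 2))).image
          (fun z => (castSite z : Site (F.P Kt) 0))) → q ∈ W) →
      ∀ ⦃δW : ℝ⦄, 0 < δW → δW < ρ → δW < ρτ →
      (∀ (ν' : Fin (F.P Kt).d), ∀ z ∈ box (fun κ => (hi κ - lo κ + 1).toNat + 3) (fun κ => lo κ - 2), ∀ b₀ : PBond (F.P Kt) 0,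
        (b₀ ∈ feeds k (⟨(castSite z : Site (F.P Kt) k), ⟨0, h0⟩⟩ : PBond (F.P Kt) k) ∨ b₀ ∈ feeds k (⟨((castSite z : Site (F.P Kt) k)).shift ⟨0, h0⟩, ν'⟩ : PBond (F.P Kt) k)
        ∨ b₀ ∈ feeds k (⟨((castSite z : Site (F.P Kt) k)).shift ν', ⟨0, h0⟩⟩ : PBond (F.P Kt) k) ∨ b₀ ∈ feeds k (⟨(castSite z : Site (F.P Kt) k), ν'⟩ : PBond (F.P Kt) k)) →
        ‖((U₀ b₀ : SU2) : Matrix (Fin 2) (Fin 2) ℂ) - 1‖ ≤ δW) →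
      ∃ (Ψ₂ : (PBond (F.P Kt) 0 → lieSU (Fin 2)) →L[ℝ] (PBond (F.P Kt) 0 → lieSU (Fin 2)) →L[ℝ] (Fin (constrCard (Bj ν.M₁ Z k) k) → lieSU (Fin 2)))
        (lam : (Fin (constrCard (Bj ν.M₁ Z k) k) → lieSU (Fin 2)) →L[ℝ] ℝ)
        (p : Seminorm ℝ (PBond (F.P Kt) 0 → lieSU (Fin 2))),
        HasFDerivAt (fun Y => fderiv ℝ (msChart F 2 Kt k (Bj ν.M₁ Z k) (avgFamily (avOfRecord F 2 Kt) (qsstarGIter0 k (ext Vk))) U₀) Y) Ψ₂ 0 ∧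
        (∀ᶠ Y in 𝓝 (0 : PBond (F.P Kt) 0 → lieSU (Fin 2)), DifferentiableAt ℝ (msChart F 2 Kt k (Bj ν.M₁ Z k) (avgFamily (avOfRecord F 2 Kt) (qsstarGIter0 k (ext Vk))) U₀) Y) ∧
        fderiv ℝ (fun Y : PBond (F.P Kt) 0 → lieSU (Fin 2) => wilsonAction4 (expChart U₀ Y)) 0 = lam.comp (fderiv ℝ (msChart F 2 Kt k (Bj ν.M₁ Z k) (avgFamily (avOfRecord F 2 Kt) (qsstarGIter0 k (ext Vk))) U₀) 0) ∧
        (∀ Y : PBond (F.P Kt) 0 → lieSU (Fin 2), ∑ b, ‖(Y b : Matrix (Fin 2) (Fin 2) ℂ)‖ ^ 2 ≤ p Y ^ 2) ∧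
        ∀ X : GaugeSlice (pts k Λ) T E3,
          lam (Ψ₂ (fderiv ℝ Xf 0 X) (fderiv ℝ Xf 0 X))
              ≤ (2 * (((F.P Kt).d : ℝ) - 1) * εP * Real.sqrt (Fintype.card (PBond (F.P Kt) 0)) * B * M₂) * p (fderiv ℝ Xf 0 X) ^ 2 ∧
          p (fderiv ℝ Xf 0 X) ≤ (12 * 𝓐₀ / R * Real.sqrt (Nat.card {b : PBond (F.P Kt) 0 // b.src ∈ maxDomT ν.M₁ Z 1})) * ‖X‖ ∧
          (((F.P Kt).L : ℝ) ^ (F.P Kt).d) ^ k / ((((F.P Kt).L : ℝ)) ^ 2 * ((F.P Kt).L : ℝ) ^ 2) ^ k / 2 * (∑ z ∈ box (fun κ => (hi κ - lo κ + 1).toNat + 3) (fun κ => lo κ - 2), ∑ μ : Fin (F.P Kt).d, ∑ a : Fin 3, curl (fun b => ιA (pts k Λ) T X (⟨castSite b.1, b.2⟩ : PBond (F.P Kt) k) a) z ⟨0, h0⟩ μ ^ 2)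
              - (((F.P Kt).L : ℝ) ^ (F.P Kt).d) ^ k / ((((F.P Kt).L : ℝ)) ^ 2 * ((F.P Kt).L : ℝ) ^ 2) ^ k * (8 * (((F.P Kt).d : ℝ) + 1) * (2 * (Kτ + 1) * δW) + 8 * ((F.P Kt).d : ℝ) * (((box (fun κ => (hi κ - lo κ + 1).toNat + 3) (fun κ => lo κ - 2)).image (fun z => (castSite z : Site (F.P Kt) k))).card : ℝ) * (C * δW * (12 * 𝓐₀ / R * Real.sqrt (Nat.card {b : PBond (F.P Kt) 0 // b.src ∈ maxDomT ν.M₁ Z 1}))) ^ 2) * ‖X‖ ^ 2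
            ≤ ((Fintype.card (Fin 2) : ℝ)⁻¹ • ∑ p ∈ W, (innerSL ℝ (E := lieSU (Fin 2))).bilinearComp
              (ContinuousLinearMap.proj (R := ℝ) (φ := fun _ : PBond (F.P Kt) 0 => lieSU (Fin 2)) (⟨p.src, p.μ⟩ : PBond (F.P Kt) 0) + ContinuousLinearMap.proj (R := ℝ) (φ := fun _ : PBond (F.P Kt) 0 => lieSU (Fin 2)) (⟨p.src.shift p.μ, p.ν⟩ : PBond (F.P Kt) 0)
                - ContinuousLinearMap.proj (R := ℝ) (φ := fun _ : PBond (F.P Kt) 0 => lieSU (Fin 2)) (⟨p.src.shift p.ν, p.μ⟩ : PBond (F.P Kt) 0) - ContinuousLinearMap.proj (R := ℝ) (φ := fun _ : PBond (F.P Kt) 0 => lieSU (Fin 2)) (⟨p.src, p.ν⟩ : PBond (F.P Kt) 0) : (PBond (F.P Kt) 0 → lieSU (Fin 2)) →L[ℝ] lieSU (Fin 2))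
              (ContinuousLinearMap.proj (R := ℝ) (φ := fun _ : PBond (F.P Kt) 0 => lieSU (Fin 2)) (⟨p.src, p.μ⟩ : PBond (F.P Kt) 0) + ContinuousLinearMap.proj (R := ℝ) (φ := fun _ : PBond (F.P Kt) 0 => lieSU (Fin 2)) (⟨p.src.shift p.μ, p.ν⟩ : PBond (F.P Kt) 0)
                - ContinuousLinearMap.proj (R := ℝ) (φ := fun _ : PBond (F.P Kt) 0 => lieSU (Fin 2)) (⟨p.src.shift p.ν, p.μ⟩ : PBond (F.P Kt) 0) - ContinuousLinearMap.proj (R := ℝ) (φ := fun _ : PBond (F.P Kt) 0 => lieSU (Fin 2)) (⟨p.src, p.ν⟩ : PBond (F.P Kt) 0) : (PBond (F.P Kt) 0 → lieSU (Fin 2)) →L[ℝ] lieSU (Fin 2))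
              : (PBond (F.P Kt) 0 → lieSU (Fin 2)) →L[ℝ] (PBond (F.P Kt) 0 → lieSU (Fin 2)) →L[ℝ] ℝ) (fderiv ℝ Xf 0 X) (fderiv ℝ Xf 0 X) := by
  classical
  -- ### the `linAvg` iterate and the explicit junction seminorm (for the velocity-form clause's constants)
  let Q : (i : ℕ) → (PBond (F.P Kt) 0 → Matrix (Fin 2) (Fin 2) ℂ) → PBond (F.P Kt) i → Matrix (Fin 2) (Fin 2) ℂ := fun i =>
    Nat.rec (motive := fun i => (PBond (F.P Kt) 0 → Matrix (Fin 2) (Fin 2) ℂ) → PBond (F.P Kt) i → Matrix (Fin 2) (Fin 2) ℂ)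
      (fun Y => Y) (fun _ q Y c => linAvg (q Y) c) i
  have hQ0 : ∀ Y, Q 0 Y = Y := fun Y => rfl
  have hQs : ∀ (i : ℕ) (Y : PBond (F.P Kt) 0 → Matrix (Fin 2) (Fin 2) ℂ) (c : PBond (F.P Kt) (i + 1)), Q (i + 1) Y c = linAvg (Q i Y) c :=
    fun i Y c => rfl
  let p₀ : Seminorm ℝ (PBond (F.P Kt) 0 → lieSU (Fin 2)) :=
    (normSeminorm ℝ (PiLp 2 (fun _ : PBond (F.P Kt) 0 => lieSU (Fin 2)))).comp (WithLp.linearEquiv 2 ℝ (PBond (F.P Kt) 0 → lieSU (Fin 2))).symm.toLinearMap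
  have hp₀ : ∀ Y : PBond (F.P Kt) 0 → lieSU (Fin 2), ∑ b, ‖(Y b : Matrix (Fin 2) (Fin 2) ℂ)‖ ^ 2 ≤ p₀ Y ^ 2 := fun Y => sum_opNorm_sq_le_l2Seminorm_sq Y
  -- ### the per-height constants
  obtain ⟨C, ρ, hC, hρ, hmX⟩ := exists_hmX_federbush_window_of_isMinimizer_family (F := F) (K := Kt) (M₁ := ν.M₁) h0 hk Q hQ0 hQs p₀ hp₀
  obtain ⟨Kτ, ρτ, hKτ, hρτ, htw⟩ := exists_twistSize_of_nearFlat_feeds (F := F) (N := 2) Kt k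
  refine ⟨C, ρ, Kτ, ρτ, hC, hρ, hKτ, hρτ, ?_⟩
  intro ext Vk R 𝓐₀ hR h𝓐₀ U₀ Xf hmin0 hsb εP hεP0 hP H B hB0 hHinv hHB hHsupp M₂ hM₂0 hM₂ hX₀ hXc hmin hKb hsupp W hWin δW hδW0 hδWρ hδWτ hδW
  -- ### the chart rows (P1)
  obtain ⟨Ψ₂, lam, p, hΨ₂, hΨd, hlam, hp, -, hrows⟩ :=
    chartRows_direct_of_letters ν Kt Z Λ T ext Vk hR h𝓐₀ U₀ Xf hmin0 hsb hεP0 hP H hB0 hHinv hHB hHsupp hM₂0 hM₂ hKb hsupp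
  refine ⟨Ψ₂, lam, p, hΨ₂, hΨd, hlam, hp, fun X => ⟨(hrows X).1, (hrows X).2, ?_⟩⟩
  -- ### the velocity-form Federbush clause: region letters discharged by the block tower of the box (as p646479 §1)
  have hUfib : AgreeOn (Bj ν.M₁ Z k) (avgFamily (avOfRecord F 2 Kt) U₀) (avgFamily (avOfRecord F 2 Kt) (qsstarGIter0 k (ext Vk))) := hmin0.2.1
  let Sset : (i : ℕ) → Finset (Site (F.P Kt) i) := fun i =>
    (box (fun κ => (F.P Kt).L ^ (k - i) * (((hi κ - lo κ + 1).toNat + 3) + 1) - 1) (fun κ => ((F.P Kt).L : ℤ) ^ (k - i) * (lo κ - 2))).image (fun z => (castSite z : Site (F.P Kt) i))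
  have hSk : Sset k = (box (fun κ => (hi κ - lo κ + 1).toNat + 3) (fun κ => lo κ - 2)).image (fun z => (castSite z : Site (F.P Kt) k)) := by
    simp only [Sset, Nat.sub_self, pow_zero, one_mul, Nat.add_sub_cancel]
  have hwin : ∀ z ∈ box (fun κ => (hi κ - lo κ + 1).toNat + 3) (fun κ => lo κ - 2), (castSite z : Site (F.P Kt) k) ∈ Sset k := fun z hz => by
    rw [hSk]
    exact Finset.mem_image_of_mem _ hz
  have hS : ∀ (ν' : Fin (F.P Kt).d), (⟨0, h0⟩ : Fin (F.P Kt).d) ≠ ν' → ∀ i, i < k → ∀ y ∈ Sset (i + 1), ∀ (r : Fin (F.P Kt).d → Fin (F.P Kt).L) (s t : ℕ),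
      s < (F.P Kt).L → t < (F.P Kt).L → runSite (runSite (Site.blockSite y r) ⟨0, h0⟩ s) ν' t ∈ Sset i := by
    intro ν' hν i hi y hy r s t hs ht
    exact runSite_runSite_blockSite_mem_tower h0 (lt_of_lt_of_le hi hk) hν hi hy r hs ht
  have hΩk : ∀ (ν' : Fin (F.P Kt).d), ∀ s ∈ Sset k, s ∈ pts k (maxDomT ν.M₁ Z k) ∧ s.shift ⟨0, h0⟩ ∈ pts k (maxDomT ν.M₁ Z k) ∧ s.shift ν' ∈ pts k (maxDomT ν.M₁ Z k) := by
    intro ν' s hs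
    rw [hSk, Finset.mem_image] at hs
    obtain ⟨z, hz, rfl⟩ := hs
    exact hΩw ν' z hz
  have hW0 : ∀ q : Plaq (F.P Kt) 0, q.src ∈ Sset 0 → q ∈ W := fun q hq => hWin q (by simpa only [Sset, Nat.sub_zero] using hq)
  have hcons := hcons_of_plaqsInside_maxDomT h0 Z (Sset k) hΩk
  -- near-flatness on the feeds of the region's plaquette bonds, re-indexed through `S_k = castSite″ box`
  have hδW' : ∀ (ν' : Fin (F.P Kt).d), ∀ s ∈ Sset k, ∀ b₀ : PBond (F.P Kt) 0,
      (b₀ ∈ feeds k (⟨s, ⟨0, h0⟩⟩ : PBond (F.P Kt) k) ∨ b₀ ∈ feeds k (⟨(s).shift ⟨0, h0⟩, ν'⟩ : PBond (F.P Kt) k)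
        ∨ b₀ ∈ feeds k (⟨(s).shift ν', ⟨0, h0⟩⟩ : PBond (F.P Kt) k) ∨ b₀ ∈ feeds k (⟨s, ν'⟩ : PBond (F.P Kt) k)) →
      ‖((U₀ b₀ : SU 2) : Matrix (Fin 2) (Fin 2) ℂ) - 1‖ ≤ δW := by
    intro ν' s hs b₀ hb₀
    rw [hSk, Finset.mem_image] at hs
    obtain ⟨z, hz, rfl⟩ := hs
    exact hδW ν' z hz b₀ hb₀
  -- the twist size at the region's plaquette bonds from the tower near-flatness
  have htwb : ∀ (c : PBond (F.P Kt) k), c ∈ bondsOf (Bj ν.M₁ Z k k) →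
      (∀ b₀ ∈ feeds k c, ‖((U₀ b₀ : SU 2) : Matrix (Fin 2) (Fin 2) ℂ) - 1‖ ≤ δW) →
      ‖((avgFamily (avOfRecord F 2 Kt) (qsstarGIter0 k (ext Vk)) k c : SU 2) : Matrix (Fin 2) (Fin 2) ℂ) - 1‖ ≤ (2 * (Kτ + 1) * δW) / 2 := by
    intro c hc hloc
    have h := htw (Bj ν.M₁ Z k) (avgFamily (avOfRecord F 2 Kt) (qsstarGIter0 k (ext Vk))) U₀ hk hUfib c hc hδW0.le hδWτ hloc
    have h2 : Kτ * δW ≤ (2 * (Kτ + 1) * δW) / 2 := by nlinarith [hδW0.le]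
    exact h.trans h2
  have hW' : ∀ (ν' : Fin (F.P Kt).d), ∀ s ∈ Sset k,
      ‖((avgFamily (avOfRecord F 2 Kt) (qsstarGIter0 k (ext Vk)) k ⟨s, ⟨0, h0⟩⟩ : SU 2) : Matrix (Fin 2) (Fin 2) ℂ) - 1‖ ≤ (2 * (Kτ + 1) * δW) / 2 ∧
      ‖((avgFamily (avOfRecord F 2 Kt) (qsstarGIter0 k (ext Vk)) k ⟨s.shift ⟨0, h0⟩, ν'⟩ : SU 2) : Matrix (Fin 2) (Fin 2) ℂ) - 1‖ ≤ (2 * (Kτ + 1) * δW) / 2 ∧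
      ‖((avgFamily (avOfRecord F 2 Kt) (qsstarGIter0 k (ext Vk)) k ⟨s.shift ν', ⟨0, h0⟩⟩ : SU 2) : Matrix (Fin 2) (Fin 2) ℂ) - 1‖ ≤ (2 * (Kτ + 1) * δW) / 2 ∧
      ‖((avgFamily (avOfRecord F 2 Kt) (qsstarGIter0 k (ext Vk)) k ⟨s, ν'⟩ : SU 2) : Matrix (Fin 2) (Fin 2) ℂ) - 1‖ ≤ (2 * (Kτ + 1) * δW) / 2 := by
    intro ν' s hs
    obtain ⟨h1, h2, h3, h4⟩ := hcons ν' s hs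
    exact ⟨htwb _ h1 fun b₀ hb₀ => hδW' ν' s hs b₀ (Or.inl hb₀), htwb _ h2 fun b₀ hb₀ => hδW' ν' s hs b₀ (Or.inr (Or.inl hb₀)),
      htwb _ h3 fun b₀ hb₀ => hδW' ν' s hs b₀ (Or.inr (Or.inr (Or.inl hb₀))), htwb _ h4 fun b₀ hb₀ => hδW' ν' s hs b₀ (Or.inr (Or.inr (Or.inr hb₀)))⟩
  have hτ : 0 < (2 * (Kτ + 1) * δW) := by positivity
  have hΨ : DifferentiableAt ℝ (msChart F 2 Kt k (Bj ν.M₁ Z k) (avgFamily (avOfRecord F 2 Kt) (qsstarGIter0 k (ext Vk))) U₀) 0 := differentiableAt_msChart hUfib hsb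
  have hX1 : HasFDerivAt Xf (fderiv ℝ Xf 0) 0 := (hXc.differentiableAt two_ne_zero).hasFDerivAt
  have hη0 : (0 : ℝ) < 1 / 2 := by norm_num
  have hη1 : (1 : ℝ) / 2 < 1 := by norm_num
  -- (K) for the explicit seminorm `p₀`
  have hK0 : ∀ X' : GaugeSlice (pts k Λ) T E3, p₀ (fderiv ℝ Xf 0 X') ≤ (12 * 𝓐₀ / R * Real.sqrt (Nat.card {b : PBond (F.P Kt) 0 // b.src ∈ maxDomT ν.M₁ Z 1})) * ‖X'‖ := by
    intro X'
    have ha : 0 ≤ 12 * 𝓐₀ / R * ‖X'‖ := by positivity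
    have h := l2Seminorm_le_of_bound_of_support (N := 2) (maxDomT ν.M₁ Z 1) (fderiv ℝ Xf 0 X') ha (fun b => (hKb X' b).2) (fun b hb => hsupp X' b hb)
    calc p₀ (fderiv ℝ Xf 0 X') ≤ Real.sqrt (Nat.card {b : PBond (F.P Kt) 0 // b.src ∈ maxDomT ν.M₁ Z 1}) * (12 * 𝓐₀ / R * ‖X'‖) := h
      _ = (12 * 𝓐₀ / R * Real.sqrt (Nat.card {b : PBond (F.P Kt) 0 // b.src ∈ maxDomT ν.M₁ Z 1})) * ‖X'‖ := by ring
  -- the velocity-form clause at `η = 1∕2` (Pauli coordinates eliminated in term mode)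
  have key := exists_lieSU2Coord.elim fun φ hφ =>
    hmX Z X (fun κ => lo κ - 2) hbox Sset hwin hS hφ hΩk (regMSCoPOfRecord F 2 ν Kt k (maxDomT ν.M₁ Z)) (ext Vk) U₀ hX₀ hmin hX1 hΨ hτ hW' W hW0 hδW0.le hδWρ hδW' hη0 hη1
  -- arithmetic: `(C·δ_W·p₀(X_f′X))² ≤ (C·δ_W·Kc)²‖X‖²`, `|S_k|` of the statement = `(S_k).card`
  have hcard : ((Sset k).card : ℝ) = (((box (fun κ => (hi κ - lo κ + 1).toNat + 3) (fun κ => lo κ - 2)).image (fun z => (castSite z : Site (F.P Kt) k))).card : ℝ) := by rw [hSk]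
  have hpK : (C * δW * p₀ (fderiv ℝ Xf 0 X)) ^ 2 ≤ (C * δW * (12 * 𝓐₀ / R * Real.sqrt (Nat.card {b : PBond (F.P Kt) 0 // b.src ∈ maxDomT ν.M₁ Z 1}))) ^ 2 * ‖X‖ ^ 2 := by
    have h1 : 0 ≤ C * δW * p₀ (fderiv ℝ Xf 0 X) := by positivity
    have h2 : C * δW * p₀ (fderiv ℝ Xf 0 X) ≤ C * δW * ((12 * 𝓐₀ / R * Real.sqrt (Nat.card {b : PBond (F.P Kt) 0 // b.src ∈ maxDomT ν.M₁ Z 1})) * ‖X‖) := mul_le_mul_of_nonneg_left (hK0 X) (by positivity)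
    calc (C * δW * p₀ (fderiv ℝ Xf 0 X)) ^ 2 ≤ (C * δW * ((12 * 𝓐₀ / R * Real.sqrt (Nat.card {b : PBond (F.P Kt) 0 // b.src ∈ maxDomT ν.M₁ Z 1})) * ‖X‖)) ^ 2 := pow_le_pow_left₀ h1 h2 2
      _ = (C * δW * (12 * 𝓐₀ / R * Real.sqrt (Nat.card {b : PBond (F.P Kt) 0 // b.src ∈ maxDomT ν.M₁ Z 1}))) ^ 2 * ‖X‖ ^ 2 := by ring
  have hratio : 0 ≤ (((F.P Kt).L : ℝ) ^ (F.P Kt).d) ^ k / ((((F.P Kt).L : ℝ)) ^ 2 * ((F.P Kt).L : ℝ) ^ 2) ^ k := by positivity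
  have hinv : ((1 : ℝ) / 2)⁻¹ - 1 = 1 := by norm_num
  have hhalf : (1 : ℝ) - 1 / 2 = 1 / 2 := by norm_num
  rw [hinv, hhalf, one_mul, hcard] at key
  have h3 : (((F.P Kt).L : ℝ) ^ (F.P Kt).d) ^ k / ((((F.P Kt).L : ℝ)) ^ 2 * ((F.P Kt).L : ℝ) ^ 2) ^ k * (8 * ((F.P Kt).d : ℝ) * (((box (fun κ => (hi κ - lo κ + 1).toNat + 3) (fun κ => lo κ - 2)).image (fun z => (castSite z : Site (F.P Kt) k))).card : ℝ) * (C * δW * p₀ (fderiv ℝ Xf 0 X)) ^ 2)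
      ≤ (((F.P Kt).L : ℝ) ^ (F.P Kt).d) ^ k / ((((F.P Kt).L : ℝ)) ^ 2 * ((F.P Kt).L : ℝ) ^ 2) ^ k * (8 * ((F.P Kt).d : ℝ) * (((box (fun κ => (hi κ - lo κ + 1).toNat + 3) (fun κ => lo κ - 2)).image (fun z => (castSite z : Site (F.P Kt) k))).card : ℝ) * ((C * δW * (12 * 𝓐₀ / R * Real.sqrt (Nat.card {b : PBond (F.P Kt) 0 // b.src ∈ maxDomT ν.M₁ Z 1}))) ^ 2 * ‖X‖ ^ 2)) :=
    mul_le_mul_of_nonneg_left (mul_le_mul_of_nonneg_left hpK (by positivity)) hratio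
  refine le_trans ?_ key
  linarith [h3]

end Package

end Summit.QuantumFields.YangMills.BalabanUVNodes.N12DirectChartPackage

end
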